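import Summits.QuantumFields.YangMills.Theorems.BalabanUVNodesN27SpineRecordJoin
import Summits.QuantumFields.YangMills.Theorems.BalabanUVNodesN19CentreSync

/-!
# BalabanUVNodes ∕ N27 spine-record join, III — the SYNCHRONISED form: hazard H-U5b-1 for the E-ledger SUPPLIED BY THE
# IN-EDGES N17 · N18 · N22 (dag-n19-a's `BalabanUVNodesN19CentreSync`, p411746) transported to node U2's OUTPUT letter (so that
# the offset `K₀` of the E1∕E2 dictionary stays free) and composed to binder B5 at the datum — the (2.25)-ledger link of
# `BalabanUVNodesN27SpineRecordJoin` loses its conclusion-flavoured binder `hdevU` in favour of the structural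
# `C.transport oneB = oneA` and the other-kinds centre clause `∃ c₀ s, Summable s ∧ |cO K t τ − c₀ K| ≤ vol·s K`

Cell `pub-ymgap`, HUMAN RULING D-0062 Track A, seat `pub-ymgap-dag-n27-a` g2 (KNIT-BY-NAME, node N27 = binder B5); `--supports
stmt-QuantumFields-19182` (chair R432), count-neutral.  Companion of `BalabanUVNodesN27SpineRecordJoin` (p411789, U2-OUTPUT letter with
`hdevU`) and `…JoinN17` (N17 itself by name via `nodeU2_of_N17`).

WHY THIS FILE.  Referee ref-B's READ #17 (INBOX l.9244) GAP-STATED the binder (D) `hdevU` of the N19 knits as N19's OWN unprinted content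
(hazard H-U5b-1: the per-term CENTRES are `(t, τ)`-independent up to a summable `vol·s K`) — and in the degenerate class expansion (one class
= the whole dressed partition function, empty ledger) `hdevU` IS matching modulo constants itself.  dag-n19-a's v2 knit
`N19CentreSync.core_summable_of_spineNodes_sync` DISCHARGED the E-ledger half of (D) from N17 · N18 · N22 BY NAME (`abs_const_sub_le_tower`:
`|E^B(X; g^B, 1_B) − E^A(X; g^A, 1_A)| ≤ (b + C₅)θ′^{sc X}e^{−κd(X)}` at every cutoff, given `C.transport oneB = oneA`; `abs_rateCentre_le`,
`abs_centre_sub_le`), in the letter of node U2's INPUTS (`ScaleShiftRate` + `RGEqH` + the infrared pin `g K K = gIR`).  At the datum with a FREE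
offset `K₀` the run of the E1∕E2 dictionary at cutoff `K` is the `(K₀+K)`-step run `Spine.NE4.runFlow D g₀ (K₀+K)`, pinned at index `K₀ + K`,
not `K` — so the input letter does not re-base, whereas node U2's OUTPUT `U2Output D g₀` (a `K`-uniform `InjectedRate`) does
(`BalabanUVNodesN27SpineRecord.injectedRate_shift`).  Hence: §1 the output-letter twin of `abs_const_sub_le_tower`; §2 the output-letter
twin of the v2 knit (n19-b's `N19SizeWindow.core_summable_of_nodes_polySize` with `hdevU` ↦ `hone` + `hcO`, size binder ZERO-CENTRED as
[Balaban1988Convergent] (2.43) prints it); §3 the string-level and datum-level N27 joins in that form.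

WHAT IS KERNEL-CHECKED ([folklore]: composition of landed tree theorems BY NAME; 0 `def`, 0 `sorry`).
* §1 `abs_const_sub_le_tower_of_injectedRate` — N22 `NE9 ∧ FadingMemory` · N18 `NE5` (worsened to `θ′`) · node U2's OUTPUT
  `InjectedRate Cd 0 θc (disc (g K) (g (K+1)))` · the box · both runs' tables in the window · `max(ω, θc) < θ′` · `C.transport oneB = oneA`
  ⇒ `|E^B(X; g^B_K, 1_B) − E^A(X; g^A_K, 1_A)| ≤ (C₉(γ³Cd)θ′∕(θ′ − max(ω,θc)) + C₅)·θ′^{sc X}·e^{−κd(X)}` for `sc X ≤ K`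
  (`T4TowerRateComposition.couplingRate_pair_of_injectedDisc` + `historySum_le_rate_of_lt` + `abs_const_sub_le` BY NAME).
* §2 `core_summable_of_nodes_polySize_sync` — `N19SizeWindow.core_summable_of_nodes_polySize` with `hdevU` REPLACED by `hone` + `hcO` and the
  size binder zero-centred ⇒ `∃ δ, Spine.NE7.Core l₀ vol T Bad P Q δ ∧ Summable δ` (proof = dag-n19-a's v2 proof with `uRateUpTo_of_nodes` and §1).
* §3 `stringHybridNE7_of_spineRecord_sync` (string level) and **`hybridNE7Under_of_spineRecordAtDatum_sync`** (datum level): the theorems of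
  `BalabanUVNodesN27SpineRecordJoin` with the ledger link `hLink` shortened accordingly and `hone` top-level.
After this file the hypotheses of the N27 join that are NOT a sibling node's statement of record are: the carriers themselves, the E1∕E2
dictionary (the class expansion — the dagwriter's `S_N27x` ∕ the crux's `stub_classExpansionAtRecord`), the (2.25) TERM FORMAT (F) with its
integrability∕scale∕positivity∕vanishing clauses, the one-run SIZE binder (S) in the (2.43)-window profile (printed-grade, node N11's leaf), the
MULTIPLICITY (M) ((0.26), node N09's), the OTHER KINDS' two-run centring (O′) (sibling rows: R-kind, boundary kind, run B's first step, N14's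
D-terms), `PolyLipGrowth` (T) (printed-grade), the window memberships, `C.transport oneB = oneA`, and the letters' signs∕rate ordering — NODE O ∕
Link content, none conclusion-shaped.

HONEST FRAMING.  COMPOSITE-node bookkeeping BY NAME over hypothesis shapes (NE3, NE4's out-edge, NE5, NE9, NE7b, NE7c — none printed for
Bałaban's d = 4 procedure, none proved); nothing of Bałaban's instantiated; NO node discharged; (B) and `Hβ` antecedents, used, never refuted;
one fixed finite four-torus — NOT ℝ⁴, NOT infinite volume, NOT OS, NOT a mass gap, NOT Clay.  Typed 28∕28 · discharged 1∕28 unchanged.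
Printed context = LOCATIONS only: [Balaban1988Convergent] CMP **119** (2.25) p. 259, Thm 2 (2.43) p. 263; [Balaban1987RG1] CMP **109** (0.26)
p. 257, Thm 2 p. 259; [King1986] CMP **102** (3.10)–(3.13) pp. 656–657 (template).  No decl below carries a cite tag.
-/

open Finset MeasureTheory

namespace Summit.QuantumFields.YangMills.Theorems.BalabanUVNodesN27SpineRecord

open Literature.MathematicalPhysics.QuantumFieldTheory.Balaban1983to89
open Literature.MathematicalPhysics.QuantumFieldTheory.Balaban1983to89.T4Continuum
open T4OutputRate T4RecentScale T4GoodClassBudget T4CauchySum T4TowerRateComposition T4TowerRateDischarge T4TermwiseBudget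
open T4WeightBudget (RelWeightBound)
open T4IndicatorShell (ShellWeightBound)
open T4MatchingAssembly (HybridNE7 StringHybridNE7)
open T4EtaRateMin (Readings NE3Shape)
open T4RateLiaison (GaugeDominated)
open T4ContinuumYM4Torus (ForSmallCouplings)
open Summit.QuantumFields.BalabanUV.T4Continuum.Spine
open Summit.QuantumFields.BalabanUV.T4Continuum.Spine.NE4 (NE4OnData U2Output runFlow)
open Summit.QuantumFields.YangMills.BalabanUVNodes.N19CoreKnit (termBudget_of_towerRate_sizeProfile core_summable_of_termBudget
  summable_eBranch_windowSize)
open Summit.QuantumFields.YangMills.BalabanUVNodes.N19CentreSync (abs_rateCentre_le abs_centre_sub_le)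

/-! ## §1 The field-independent constants are rate-small along the tower — node U2's OUTPUT letter -/

section Constants

variable {C : Carriers}

/-- **OUTPUT-LETTER TWIN OF `N19CentreSync.abs_const_sub_le_tower`.**  N22 = `NE9 ∧ FadingMemory`, N18 = `NE5` (worsened to `θ′`), node U2's
OUTPUT `InjectedRate Cd 0 θc (disc (g K) (g (K+1)))` on the box `]0, γ]` (so consecutive runs' couplings differ by `≤ γ³·Cd·θc^i`,
`couplingRate_pair_of_injectedDisc`), both runs' tables in the window, `max(ω, θc) < θ′`, and run B's unit background transporting to run A's
(`C.transport oneB = oneA`) ⇒ at every cutoff `K` and every domain `X` of scale `≤ K`: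
`|E^B(X; g^B_K, 1_B) − E^A(X; g^A_K, 1_A)| ≤ (C₉·(γ³Cd)·θ′∕(θ′ − max(ω,θc)) + C₅)·θ′^{sc X}·e^{−κd(X)}`. [folklore] -/
theorem abs_const_sub_le_tower_of_injectedRate {W : Set (ℕ → ℝ)} {EA : Functional C C.BgA} {EB : Functional C C.BgB}
    {κ θ₅ C₅ C₉ ω θc Cd γ θ' : ℝ} {Λ : ℕ → ℕ → ℝ} {g : ℕ → ℕ → ℝ} {oneA : C.BgA} {oneB : C.BgB}
    (h22 : NE9 EA W κ Λ ∧ FadingMemory C₉ ω Λ) (hω : 0 ≤ ω)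
    (h18 : NE5 EA EB W κ θ₅ C₅) (hθ₅ : 0 ≤ θ₅) (hC₅ : 0 ≤ C₅)
    (hinj : InjectedRate Cd 0 θc (fun K j => T4CouplingMatching.disc (g K) (g (K + 1)) j)) (hCd : 0 ≤ Cd)
    (hθc : 0 ≤ θc) (hbox : ∀ K i, i ≤ K → 0 < g K i ∧ g K i ≤ γ)
    (hgA : ∀ K, g K ∈ W) (hgB : ∀ K, (fun i => g (K + 1) (i + 1)) ∈ W)
    (hθ' : max ω θc < θ') (hθ₅' : θ₅ ≤ θ') (hone : C.transport oneB = oneA)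
    (K : ℕ) (X : C.Dom) (hX : C.scale X ≤ K) :
    |EB (fun i => g (K + 1) (i + 1)) oneB X - EA (g K) oneA X|
      ≤ (C₉ * (γ ^ 3 * Cd) * (θ' / (θ' - max ω θc)) + C₅) * θ' ^ C.scale X * Real.exp (-(κ * C.d X)) := by
  have hD : 0 ≤ γ ^ 3 * Cd := mul_nonneg (pow_nonneg (box_nonneg hbox) 3) hCd
  have hcoup : ∀ i < C.scale X, |g K i - (fun n => g (K + 1) (n + 1)) i| ≤ γ ^ 3 * Cd * θc ^ i :=
    fun i hi => couplingRate_pair_of_injectedDisc hinj hbox K i (by omega)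
  have hbX := historySum_le_rate_of_lt h22.2 hω hθc hD hθ' hcoup
  exact abs_const_sub_le h22.1 (ne5_mono h18 hθ₅ hθ₅' hC₅) (hgA K) (hgB K) hone X hbX

end Constants

/-! ## §2 The N19 knit v2 (hazard H-U5b-1 supplied by the in-edges) in node U2's OUTPUT letter -/

section SpineNodes

open T4EtaRateMin (LocalRate)

variable {C : Carriers} {ι X : Type} [MeasurableSpace ι] {σ : Type*} [DecidableEq σ] {l₀ vol : ℝ}
  {T : ℕ → Finset σ} {Bad : ℕ → ℝ → Finset σ} {P Q : ℕ → ℝ → σ → ℝ} {μ : ℕ → ℝ → σ → Measure ι}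
  {fac : ℕ → ℝ → σ → Finset C.Dom} {R : Readings ι X} {W : Set (ℕ → ℝ)} {EA : Functional C C.BgA}
  {EB : Functional C C.BgB} {κ θ₅ C₅ C₉ ω θc Cd γ C₃ θ₃ Pg θ' : ℝ} {q m : ℕ} {Λm : ℕ → ℕ → ℝ}
  {CU : (ℕ → ℝ) → ℕ → ℝ} {g : ℕ → ℕ → ℝ} {uA : ℕ → ι → C.BgA} {uB : ℕ → ι → C.BgB} {oneA : C.BgA} {oneB : C.BgB}
  {oA oB : ℕ → ℝ → σ → ι → ℝ} {S : ℕ → ℝ → σ → ℕ → ℝ} {cO RO : ℕ → ℝ → σ → ℝ} {rO : ℕ → ℝ} {Cw E₀ a Λ : ℝ}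

/-- **N19 ∧ U4′ FROM THE IN-EDGES, v2, OUTPUT LETTER.**  Hypotheses: those of `N19SizeWindow.core_summable_of_nodes_polySize` (N22 `NE9 ∧
FadingMemory`; node U3's bracket `LipBackground`∕`PolyLipGrowth`; N18 `NE5`; N16 as `NE3Shape` (+ `GaugeDominated`); node U2's OUTPUT
`InjectedRate Cd 0 θc disc` on the box; windows; rate ordering; the (2.25) term format, integrability, scales, other kinds' positivity∕vanishing;
multiplicity; other kinds' centring with `RO ≤ vol·rO`, `Σ rO < ∞`) EXCEPT: the size binder `hS` is ZERO-CENTRED in the (2.43)-window profile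
`S ≤ vol·E₀(K+1)^m·a^{K−j}`, and hazard H-U5b-1 `hdevU` is DELETED in favour of `hone : C.transport oneB = oneA` and the other-kinds centre clause
`hcO : ∃ c₀ s, Summable s ∧ |cO K t τ − c₀ K| ≤ vol·s K`.  CONCLUSION: `∃ δ, Spine.NE7.Core l₀ vol T Bad P Q δ ∧ Summable δ`.  PROOF (=
dag-n19-a's `core_summable_of_spineNodes_sync` with output-letter substitutions): `uRateUpTo_of_nodes` gives the tower constant `Cr = a₀ + b +
C₅`; §1 + `abs_rateCentre_le` put the rate centres within their radii; `abs_centre_sub_le` gives the budget theorem's `hdev` for THIS `Cr` with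
`s′ = max(Cw,1)(E₀(K+1)^m + Cr)Σmin + s`; `termBudget_of_towerRate_sizeProfile (κ₁ := 0)`; `core_summable_of_termBudget`.  CONDITIONAL on every
binder; NE7 NOT PRINTED, NOT proved. [folklore] -/
theorem core_summable_of_nodes_polySize_sync
    (h22 : NE9 EA W κ Λm ∧ FadingMemory C₉ ω Λm) (hω : 0 ≤ ω)
    (hUL : LipBackground EA W κ CU) (hG : PolyLipGrowth CU g Pg q) (hPg : 0 ≤ Pg)
    (h18 : NE5 EA EB W κ θ₅ C₅) (hθ₅ : 0 ≤ θ₅) (hC₅ : 0 ≤ C₅)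
    (h16 : NE3Shape R C₃ θ₃) (hC₃ : 0 ≤ C₃) (hgd : GaugeDominated R uA uB)
    (hinj : InjectedRate Cd 0 θc (fun K j => T4CouplingMatching.disc (g K) (g (K + 1)) j)) (hCd : 0 ≤ Cd)
    (hθc : 0 ≤ θc) (hbox : ∀ K i, i ≤ K → 0 < g K i ∧ g K i ≤ γ)
    (hgA : ∀ K, g K ∈ W) (hgB : ∀ K, (fun i => g (K + 1) (i + 1)) ∈ W)
    (hθ' : max ω θc < θ') (hθ₅' : θ₅ ≤ θ') (hθ₃' : θ₃ ≤ θ') (hθ'1 : θ' < 1) (hθ'Λ : θ' ≤ Λ)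
    (hfmtA : ∀ K t τ, P K t τ = ∫ v, (∏ Y ∈ fac K t τ,
      Real.exp (EA (g K) (uA K v) Y - EA (g K) oneA Y)) * oA K t τ v ∂(μ K t τ))
    (hfmtB : ∀ K t τ, Q K t τ = ∫ v, (∏ Y ∈ fac K t τ,
      Real.exp (EB (fun i => g (K + 1) (i + 1)) (uB K v) Y - EB (fun i => g (K + 1) (i + 1)) oneB Y)) *
        oB K t τ v ∂(μ K t τ))
    (hint : ∀ K t, |t| ≤ l₀ → ∀ τ ∈ T K \ Bad K t,
      Integrable (fun v => (∏ Y ∈ fac K t τ, Real.exp (EA (g K) (uA K v) Y - EA (g K) oneA Y)) *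
        oA K t τ v) (μ K t τ) ∧
      Integrable (fun v => (∏ Y ∈ fac K t τ,
        Real.exp (EB (fun i => g (K + 1) (i + 1)) (uB K v) Y - EB (fun i => g (K + 1) (i + 1)) oneB Y)) *
        oB K t τ v) (μ K t τ))
    (hsc : ∀ K t, |t| ≤ l₀ → ∀ τ ∈ T K \ Bad K t, ∀ Y ∈ fac K t τ, C.scale Y ≤ K)
    (hposO : ∀ K t, |t| ≤ l₀ → ∀ τ ∈ T K \ Bad K t, ∀ v ∈ R.dom, 0 < oA K t τ v ∧ 0 < oB K t τ v)
    (hoff : ∀ K t, |t| ≤ l₀ → ∀ τ ∈ T K \ Bad K t, ∀ v, v ∉ R.dom →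
      (∏ Y ∈ fac K t τ, Real.exp (EA (g K) (uA K v) Y - EA (g K) oneA Y)) * oA K t τ v = 0 ∧
      (∏ Y ∈ fac K t τ,
        Real.exp (EB (fun i => g (K + 1) (i + 1)) (uB K v) Y - EB (fun i => g (K + 1) (i + 1)) oneB Y)) *
        oB K t τ v = 0)
    -- the SIZE binder, ZERO-CENTRED as (2.43) is printed, in the (2.43)-window profile
    (hS : ∀ K t, |t| ≤ l₀ → ∀ τ ∈ T K \ Bad K t, ∀ v ∈ R.dom, ∀ j ≤ K,
      |∑ Y ∈ fac K t τ with C.scale Y = j,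
          (Real.log (Real.exp (EB (fun i => g (K + 1) (i + 1)) (uB K v) Y
              - EB (fun i => g (K + 1) (i + 1)) oneB Y))
            - Real.log (Real.exp (EA (g K) (uA K v) Y - EA (g K) oneA Y)))| ≤ S K t τ j)
    (hM : ∀ K t, |t| ≤ l₀ → ∀ τ ∈ T K \ Bad K t,
      Multiplicity (fac K t τ) C.scale (fun Y => Real.exp (-(κ * C.d Y))) Cw vol Λ K)
    (hO : ∀ K t, |t| ≤ l₀ → ∀ τ ∈ T K \ Bad K t, ∀ v ∈ R.dom,
      |Real.log (oB K t τ v) - Real.log (oA K t τ v) - cO K t τ| ≤ RO K t τ)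
    (hvol : 0 ≤ vol) (hE₀ : 0 ≤ E₀) (ha0 : 0 < a) (ha1 : a < 1)
    (hSle : ∀ K t, |t| ≤ l₀ → ∀ τ ∈ T K \ Bad K t, ∀ j ≤ K,
      S K t τ j ≤ vol * (E₀ * ((K : ℝ) + 1) ^ m * a ^ (K - j)))
    (hRO : ∀ K t, |t| ≤ l₀ → ∀ τ ∈ T K \ Bad K t, RO K t τ ≤ vol * rO K) (hrO : Summable rO)
    -- replacing (D): the structural transport identity and the OTHER-KINDS CENTRE CLAUSE (O′)
    (hone : C.transport oneB = oneA)
    (hcO : ∃ c₀ s : ℕ → ℝ, Summable s ∧ ∀ K t, |t| ≤ l₀ → ∀ τ ∈ T K \ Bad K t, |cO K t τ - c₀ K| ≤ vol * s K) :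
    ∃ δ : ℕ → ℝ, NE7.Core l₀ vol T Bad P Q δ ∧ Summable δ := by
  -- node U3 composed along the tower in the OUTPUT letter, `K`-uniform constant `Cr = a₀ + b + C₅`
  obtain ⟨a₀, ha₀, hUK⟩ := uRateUpTo_of_nodes h22.1 h22.2 hω hUL hG hPg h18 hθ₅ hC₅ h16.pointwise hC₃ h16.rate_nonneg
    h16.rate_lt_one hgd hinj hCd hθc hbox hgA hgB hθ' hθ₅' hθ₃'
  have hθ'0 : 0 < θ' := lt_of_le_of_lt (hθc.trans (le_max_right ω θc)) hθ'
  have hC₉ : 0 ≤ C₉ := fadingMemory_const_nonneg h22.2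
  have hD : 0 ≤ γ ^ 3 * Cd := mul_nonneg (pow_nonneg (box_nonneg hbox) 3) hCd
  have hbr0 : 0 ≤ C₉ * (γ ^ 3 * Cd) * (θ' / (θ' - max ω θc)) :=
    mul_nonneg (mul_nonneg hC₉ hD) (div_nonneg hθ'0.le (sub_pos.mpr hθ').le)
  set Cr := a₀ + C₉ * (γ ^ 3 * Cd) * (θ' / (θ' - max ω θc)) + C₅ with hCr_def
  have hCr : 0 ≤ Cr := add_nonneg (add_nonneg ha₀ hbr0) hC₅
  -- §1: the field-independent constants are rate-small with constant `b + C₅ ≤ Cr`, at every cutoff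
  have hconst : ∀ K (Y : C.Dom), C.scale Y ≤ K →
      |(-(EB (fun i => g (K + 1) (i + 1)) oneB Y - EA (g K) oneA Y))|
        ≤ Cr * θ' ^ C.scale Y * Real.exp (-(κ * C.d Y)) := fun K Y hY => by
    rw [abs_neg]
    refine (abs_const_sub_le_tower_of_injectedRate h22 hω h18 hθ₅ hC₅ hinj hCd hθc hbox hgA hgB hθ' hθ₅' hone K Y
      hY).trans ?_
    refine mul_le_mul_of_nonneg_right (mul_le_mul_of_nonneg_right ?_ (pow_nonneg hθ'0.le _))
      (Real.exp_pos _).le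
    rw [hCr_def]
    linarith
  -- hence the rate centres are within their radii on every good term's ledger (multiplicity)
  have hκ : ∀ K t, |t| ≤ l₀ → ∀ τ ∈ T K \ Bad K t, ∀ j ≤ K,
      |∑ Y ∈ fac K t τ with C.scale Y = j, (-(EB (fun i => g (K + 1) (i + 1)) oneB Y - EA (g K) oneA Y))|
        ≤ Cw * vol * (Cr * θ' ^ j * Λ ^ (K - j)) := fun K t ht τ hτ j hj =>
    abs_rateCentre_le (fun Y hY => hconst K Y (hsc K t ht τ hτ Y hY)) (hM K t ht τ hτ) hCr hθ'0.le hj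
  -- the budget theorem's `hdev` binder for THIS `Cr`, with a summable `s′`
  obtain ⟨c₀, s, hs, hcO'⟩ := hcO
  have hdev : ∀ K t, |t| ≤ l₀ → ∀ τ ∈ T K \ Bad K t,
      |((∑ j ∈ range (K + 1), sliceCentre (fun _ => 0)
          (fun j => ∑ Y ∈ fac K t τ with C.scale Y = j,
            (-(EB (fun i => g (K + 1) (i + 1)) oneB Y - EA (g K) oneA Y)))
          (S K t τ) (fun j => Cw * vol * (Cr * θ' ^ j * Λ ^ (K - j))) j) + cO K t τ) - c₀ K|
        ≤ vol * (max Cw 1 * ((E₀ * ((K : ℝ) + 1) ^ m + Cr)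
            * ∑ x ∈ antidiagonal K, min (a ^ x.2) (θ' ^ x.1 * Λ ^ x.2)) + s K) := fun K t ht τ hτ =>
    abs_centre_sub_le hvol (by positivity) ha0.le hθ'0.le (hθ'0.le.trans hθ'Λ) hCr (hκ K t ht τ hτ)
      (hSle K t ht τ hτ) (fun j _ => le_rfl) (hcO' K t ht τ hτ)
  -- the budget theorem with the size centre `0`, then `Core ∧ Summable`
  have hT := termBudget_of_towerRate_sizeProfile (κ₁ := fun _ _ _ _ => 0) (E := fun K : ℕ => E₀ * ((K : ℝ) + 1) ^ m)
    (s := fun K => max Cw 1 * ((E₀ * ((K : ℝ) + 1) ^ m + Cr)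
      * ∑ x ∈ antidiagonal K, min (a ^ x.2) (θ' ^ x.1 * Λ ^ x.2)) + s K)
    hUK hCr hθ'0.le (hθ'0.le.trans hθ'Λ) hfmtA hfmtB hint hsc hposO hoff
    (fun K t ht τ hτ v hv j hj => by simpa only [sub_zero] using hS K t ht τ hτ v hv j hj)
    hM hO hvol (fun K => by positivity) ha0.le hSle hRO hdev
  have hsum := summable_eBranch_windowSize (m := m) hE₀ hCr ha0 ha1 hθ'0 hθ'1 hθ'Λ
  exact ⟨_, core_summable_of_termBudget hT hsum hrO ((hsum.mul_left (max Cw 1)).add hs)⟩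

end SpineNodes

/-! ## §3 The N27 joins in the synchronised form: one string; the datum -/

section Scheme

variable {G : Type*} [GaugeGroup G] [MeasurableSpace G] [HaarData G] {O : Type*}
  {C : Carriers} {ι X : Type} [MeasurableSpace ι] {σ : Type} [DecidableEq σ] {l₀ vol : ℝ}
  {T : ℕ → Finset σ} {Bad : ℕ → ℝ → Finset σ} {A B shA shB : ℕ → ℝ → σ → ℝ} {W Wsh : ℕ → ℝ}
  {μ : ℕ → ℝ → σ → Measure ι} {fac : ℕ → ℝ → σ → Finset C.Dom} {R : Readings ι X} {Wset : Set (ℕ → ℝ)}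
  {EA : Functional C C.BgA} {EB : Functional C C.BgB} {κ θ₅ C₅ C₉ ω θc Cd γ C₃ θ₃ P θ' : ℝ} {q : ℕ} {Λm : ℕ → ℕ → ℝ}
  {CU : (ℕ → ℝ) → ℕ → ℝ} {g : ℕ → ℕ → ℝ} {uA : ℕ → ι → C.BgA} {uB : ℕ → ι → C.BgB} {oneA : C.BgA} {oneB : C.BgB}
  {oA oB : ℕ → ℝ → σ → ι → ℝ} {Ssz : ℕ → ℝ → σ → ℕ → ℝ} {cO RO : ℕ → ℝ → σ → ℝ} {rO : ℕ → ℝ} {Cw a Λ E₀ : ℝ} {m : ℕ}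

/-- **ONE STRING FROM THE SPINE'S RECORD DECLS, SYNCHRONISED FORM** — `stringHybridNE7_of_spineRecord` with hazard H-U5b-1 `hdevU` REPLACED by
`hone : C.transport oneB = oneA` + the other-kinds centre clause `hcO`, and the size binder zero-centred (§2 then `stringHybridNE7_of_spineNodes_exists`).
CONDITIONAL on every binder. [bookkeeping] [folklore] -/
theorem stringHybridNE7_of_spineRecord_sync (S : Missing.TorusScheme G O) (os : List O) (K₀ : ℕ)
    (h20 : RelWeightBound l₀ T A B Bad W) (h21 : ShellWeightBound l₀ T A B shA shB Wsh) (hlt : ∀ K, W K + Wsh K < 1)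
    (hE1 : ∀ (K : ℕ) (t : ℝ), |t| ≤ l₀ → T4GenFunBounds.schemeZ S os (K₀ + K) t = ∑ τ ∈ T K, A K t τ)
    (hE2 : ∀ (K : ℕ) (t : ℝ), |t| ≤ l₀ → T4GenFunBounds.schemeZ S os (K₀ + K + 1) t = ∑ τ ∈ T K, B K t τ)
    (h22 : NE9 EA Wset κ Λm ∧ FadingMemory C₉ ω Λm) (hω : 0 ≤ ω)
    (hUL : LipBackground EA Wset κ CU) (hG : PolyLipGrowth CU g P q) (hP : 0 ≤ P)
    (h18 : NE5 EA EB Wset κ θ₅ C₅) (hθ₅ : 0 ≤ θ₅) (hC₅ : 0 ≤ C₅)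
    (h16 : NE3Shape R C₃ θ₃) (hC₃ : 0 ≤ C₃) (hgd : GaugeDominated R uA uB)
    (hinj : InjectedRate Cd 0 θc (fun K j => T4CouplingMatching.disc (g K) (g (K + 1)) j)) (hCd : 0 ≤ Cd)
    (hθc : 0 ≤ θc) (hbox : ∀ K i, i ≤ K → 0 < g K i ∧ g K i ≤ γ)
    (hgA : ∀ K, g K ∈ Wset) (hgB : ∀ K, (fun i => g (K + 1) (i + 1)) ∈ Wset)
    (hθ' : max ω θc < θ') (hθ₅' : θ₅ ≤ θ') (hθ₃' : θ₃ ≤ θ') (hθ'1 : θ' < 1) (hθ'Λ : θ' ≤ Λ)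
    (hfmtA : ∀ K t τ, A K t τ - shA K t τ = ∫ v, (∏ Y ∈ fac K t τ,
      Real.exp (EA (g K) (uA K v) Y - EA (g K) oneA Y)) * oA K t τ v ∂(μ K t τ))
    (hfmtB : ∀ K t τ, B K t τ - shB K t τ = ∫ v, (∏ Y ∈ fac K t τ,
      Real.exp (EB (fun i => g (K + 1) (i + 1)) (uB K v) Y - EB (fun i => g (K + 1) (i + 1)) oneB Y)) *
        oB K t τ v ∂(μ K t τ))
    (hint : ∀ K t, |t| ≤ l₀ → ∀ τ ∈ T K \ Bad K t,
      Integrable (fun v => (∏ Y ∈ fac K t τ, Real.exp (EA (g K) (uA K v) Y - EA (g K) oneA Y)) *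
        oA K t τ v) (μ K t τ) ∧
      Integrable (fun v => (∏ Y ∈ fac K t τ,
        Real.exp (EB (fun i => g (K + 1) (i + 1)) (uB K v) Y - EB (fun i => g (K + 1) (i + 1)) oneB Y)) *
        oB K t τ v) (μ K t τ))
    (hsc : ∀ K t, |t| ≤ l₀ → ∀ τ ∈ T K \ Bad K t, ∀ Y ∈ fac K t τ, C.scale Y ≤ K)
    (hposO : ∀ K t, |t| ≤ l₀ → ∀ τ ∈ T K \ Bad K t, ∀ v ∈ R.dom, 0 < oA K t τ v ∧ 0 < oB K t τ v)
    (hoff : ∀ K t, |t| ≤ l₀ → ∀ τ ∈ T K \ Bad K t, ∀ v, v ∉ R.dom →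
      (∏ Y ∈ fac K t τ, Real.exp (EA (g K) (uA K v) Y - EA (g K) oneA Y)) * oA K t τ v = 0 ∧
      (∏ Y ∈ fac K t τ,
        Real.exp (EB (fun i => g (K + 1) (i + 1)) (uB K v) Y - EB (fun i => g (K + 1) (i + 1)) oneB Y)) *
        oB K t τ v = 0)
    (hS : ∀ K t, |t| ≤ l₀ → ∀ τ ∈ T K \ Bad K t, ∀ v ∈ R.dom, ∀ j ≤ K,
      |∑ Y ∈ fac K t τ with C.scale Y = j,
          (Real.log (Real.exp (EB (fun i => g (K + 1) (i + 1)) (uB K v) Y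
              - EB (fun i => g (K + 1) (i + 1)) oneB Y))
            - Real.log (Real.exp (EA (g K) (uA K v) Y - EA (g K) oneA Y)))| ≤ Ssz K t τ j)
    (hM : ∀ K t, |t| ≤ l₀ → ∀ τ ∈ T K \ Bad K t,
      Multiplicity (fac K t τ) C.scale (fun Y => Real.exp (-(κ * C.d Y))) Cw vol Λ K)
    (hO : ∀ K t, |t| ≤ l₀ → ∀ τ ∈ T K \ Bad K t, ∀ v ∈ R.dom,
      |Real.log (oB K t τ v) - Real.log (oA K t τ v) - cO K t τ| ≤ RO K t τ)
    (hvol : 0 < vol) (hE₀ : 0 ≤ E₀) (ha0 : 0 < a) (ha1 : a < 1)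
    (hSle : ∀ K t, |t| ≤ l₀ → ∀ τ ∈ T K \ Bad K t, ∀ j ≤ K,
      Ssz K t τ j ≤ vol * (E₀ * ((K : ℝ) + 1) ^ m * a ^ (K - j)))
    (hRO : ∀ K t, |t| ≤ l₀ → ∀ τ ∈ T K \ Bad K t, RO K t τ ≤ vol * rO K) (hrO : Summable rO)
    (hone : C.transport oneB = oneA)
    (hcO : ∃ c₀ s : ℕ → ℝ, Summable s ∧ ∀ K t, |t| ≤ l₀ → ∀ τ ∈ T K \ Bad K t, |cO K t τ - c₀ K| ≤ vol * s K) :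
    StringHybridNE7 S os l₀ vol K₀ :=
  stringHybridNE7_of_spineNodes_exists S os K₀ h20 h21 hlt
    (core_summable_of_nodes_polySize_sync (P := fun K t τ => A K t τ - shA K t τ) (Q := fun K t τ => B K t τ - shB K t τ)
      h22 hω hUL hG hP h18 hθ₅ hC₅ h16 hC₃ hgd hinj hCd hθc hbox hgA hgB hθ' hθ₅' hθ₃' hθ'1 hθ'Λ hfmtA hfmtB hint hsc
      hposO hoff hS hM hO hvol.le hE₀ ha0 ha1 hSle hRO hrO hone hcO)
    hE1 hE2

end Scheme

section Datum

variable {F : T4Family} {G : Type*} [GaugeGroup G] [MeasurableSpace G] [HaarData G]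
  {C : Carriers} {ι X : Type} [MeasurableSpace ι] {σ : Type} [DecidableEq σ]
  {R : Readings ι X} {Wset : Set (ℕ → ℝ)} {EA : Functional C C.BgA} {EB : Functional C C.BgB}
  {κ θ₅ C₅ C₉ ω C₃ θ₃ P θ' Cw a Λ E₀ : ℝ} {q m : ℕ} {Λm : ℕ → ℕ → ℝ} {CU : (ℕ → ℝ) → ℕ → ℝ}
  {uA : ℕ → ι → C.BgA} {uB : ℕ → ι → C.BgB} {oneA : C.BgA} {oneB : C.BgB}
  {l₀ vol : (ℕ → ℝ) → List (ULoop F) → ℝ} {K₀ : (ℕ → ℝ) → List (ULoop F) → ℕ}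
  {T : (ℕ → ℝ) → List (ULoop F) → ℕ → Finset σ} {Bad : (ℕ → ℝ) → List (ULoop F) → ℕ → ℝ → Finset σ}
  {A B shA shB : (ℕ → ℝ) → List (ULoop F) → ℕ → ℝ → σ → ℝ} {W Wsh rO : (ℕ → ℝ) → List (ULoop F) → ℕ → ℝ}
  {μ : (ℕ → ℝ) → List (ULoop F) → ℕ → ℝ → σ → Measure ι} {fac : (ℕ → ℝ) → List (ULoop F) → ℕ → ℝ → σ → Finset C.Dom}
  {oA oB : (ℕ → ℝ) → List (ULoop F) → ℕ → ℝ → σ → ι → ℝ} {Ssz : (ℕ → ℝ) → List (ULoop F) → ℕ → ℝ → σ → ℕ → ℝ}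
  {cO RO : (ℕ → ℝ) → List (ULoop F) → ℕ → ℝ → σ → ℝ}

/-- **N27 = B5 AT THE DATUM FROM THE SPINE'S RECORD DECLS, SYNCHRONISED FORM** — `hybridNE7Under_of_spineRecordAtDatum` with the ledger link's
hazard binder `hdevU` REPLACED by the top-level structural `hone : C.transport oneB = oneA` and, inside `hLink`, the other-kinds centre clause
`∃ c₀ s, Summable s ∧ |cO K t τ − c₀ K| ≤ vol·s K`; the size binder zero-centred.  TOP LEVEL BY NAME: N16 `NE3Shape`, N18 `NE5`, N22
`NE9 ∧ FadingMemory`, `LipBackground`, `hone`, signs∕rate ordering.  UNDER THE PREFIX: `hU2` = THE EDGE N17 → N27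
`D.UnderHypotheses Hβ (U2Output D · Cd θc)` (any of dag-n17-a's roads), `hK5` (N20, N21, budget, E1∕E2 vs `schemeZ (D.scheme g₀) os (K₀+K)`),
`hRuns` (`PolyLipGrowth` + windows at `runFlow D g₀ (K₀ g₀ os + K)`), `hLink` (term format of the shell-free cores, integrability, scales, other
kinds' positivity∕vanishing, zero-centred size in the (2.43)-window, multiplicity, other kinds' centring (O′) with `Σ rO < ∞`).  The box is read
off `D.Tuned`.  CONCLUSION: `T4ApexHybrid.HybridNE7Under D Hβ`.  CONDITIONAL on every binder; NOT a discharge. [bookkeeping] [folklore] -/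
theorem hybridNE7Under_of_spineRecordAtDatum_sync (D : FiniteEpsData F G) {Hβ : Prop} {Cd θc : ℝ}
    (h16 : NE3Shape R C₃ θ₃) (hC₃ : 0 ≤ C₃) (hgd : GaugeDominated R uA uB)
    (h18 : NE5 EA EB Wset κ θ₅ C₅) (hθ₅ : 0 ≤ θ₅) (hC₅ : 0 ≤ C₅)
    (h22 : NE9 EA Wset κ Λm ∧ FadingMemory C₉ ω Λm) (hω : 0 ≤ ω)
    (hUL : LipBackground EA Wset κ CU) (hP : 0 ≤ P) (hone : C.transport oneB = oneA)
    (hθ' : max ω θc < θ') (hθ₅' : θ₅ ≤ θ') (hθ₃' : θ₃ ≤ θ') (hθ'1 : θ' < 1) (hθ'Λ : θ' ≤ Λ)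
    (hE₀ : 0 ≤ E₀) (ha0 : 0 < a) (ha1 : a < 1) (hCd : 0 ≤ Cd) (hθc : 0 ≤ θc)
    (hU2 : D.UnderHypotheses Hβ fun g₀ => U2Output D g₀ Cd θc)
    (hK5 : D.UnderHypotheses Hβ fun g₀ => ∀ os : List (ULoop F),
      0 < l₀ g₀ os ∧ 0 < vol g₀ os ∧
        RelWeightBound (l₀ g₀ os) (T g₀ os) (A g₀ os) (B g₀ os) (Bad g₀ os) (W g₀ os) ∧
        ShellWeightBound (l₀ g₀ os) (T g₀ os) (A g₀ os) (B g₀ os) (shA g₀ os) (shB g₀ os) (Wsh g₀ os) ∧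
        (∀ K, W g₀ os K + Wsh g₀ os K < 1) ∧
        (∀ (K : ℕ) (t : ℝ), |t| ≤ l₀ g₀ os →
          T4GenFunBounds.schemeZ (D.scheme g₀) os (K₀ g₀ os + K) t = ∑ τ ∈ T g₀ os K, A g₀ os K t τ) ∧
        (∀ (K : ℕ) (t : ℝ), |t| ≤ l₀ g₀ os →
          T4GenFunBounds.schemeZ (D.scheme g₀) os (K₀ g₀ os + K + 1) t = ∑ τ ∈ T g₀ os K, B g₀ os K t τ))
    (hRuns : D.UnderHypotheses Hβ fun g₀ => ∀ os : List (ULoop F),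
      PolyLipGrowth CU (fun K => runFlow D g₀ (K₀ g₀ os + K)) P q ∧
        (∀ K, runFlow D g₀ (K₀ g₀ os + K) ∈ Wset) ∧
        (∀ K, (fun i => runFlow D g₀ (K₀ g₀ os + (K + 1)) (i + 1)) ∈ Wset))
    (hLink : D.UnderHypotheses Hβ fun g₀ => ∀ os : List (ULoop F),
      (∀ K t τ, A g₀ os K t τ - shA g₀ os K t τ = ∫ v, (∏ Y ∈ fac g₀ os K t τ,
        Real.exp (EA (runFlow D g₀ (K₀ g₀ os + K)) (uA K v) Y - EA (runFlow D g₀ (K₀ g₀ os + K)) oneA Y)) *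
          oA g₀ os K t τ v ∂(μ g₀ os K t τ)) ∧
      (∀ K t τ, B g₀ os K t τ - shB g₀ os K t τ = ∫ v, (∏ Y ∈ fac g₀ os K t τ,
        Real.exp (EB (fun i => runFlow D g₀ (K₀ g₀ os + (K + 1)) (i + 1)) (uB K v) Y
          - EB (fun i => runFlow D g₀ (K₀ g₀ os + (K + 1)) (i + 1)) oneB Y)) * oB g₀ os K t τ v ∂(μ g₀ os K t τ)) ∧
      (∀ K t, |t| ≤ l₀ g₀ os → ∀ τ ∈ T g₀ os K \ Bad g₀ os K t,
        Integrable (fun v => (∏ Y ∈ fac g₀ os K t τ,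
          Real.exp (EA (runFlow D g₀ (K₀ g₀ os + K)) (uA K v) Y - EA (runFlow D g₀ (K₀ g₀ os + K)) oneA Y)) *
            oA g₀ os K t τ v) (μ g₀ os K t τ) ∧
        Integrable (fun v => (∏ Y ∈ fac g₀ os K t τ,
          Real.exp (EB (fun i => runFlow D g₀ (K₀ g₀ os + (K + 1)) (i + 1)) (uB K v) Y
            - EB (fun i => runFlow D g₀ (K₀ g₀ os + (K + 1)) (i + 1)) oneB Y)) * oB g₀ os K t τ v) (μ g₀ os K t τ)) ∧
      (∀ K t, |t| ≤ l₀ g₀ os → ∀ τ ∈ T g₀ os K \ Bad g₀ os K t, ∀ Y ∈ fac g₀ os K t τ, C.scale Y ≤ K) ∧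
      (∀ K t, |t| ≤ l₀ g₀ os → ∀ τ ∈ T g₀ os K \ Bad g₀ os K t, ∀ v ∈ R.dom,
        0 < oA g₀ os K t τ v ∧ 0 < oB g₀ os K t τ v) ∧
      (∀ K t, |t| ≤ l₀ g₀ os → ∀ τ ∈ T g₀ os K \ Bad g₀ os K t, ∀ v, v ∉ R.dom →
        (∏ Y ∈ fac g₀ os K t τ,
          Real.exp (EA (runFlow D g₀ (K₀ g₀ os + K)) (uA K v) Y - EA (runFlow D g₀ (K₀ g₀ os + K)) oneA Y)) *
            oA g₀ os K t τ v = 0 ∧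
        (∏ Y ∈ fac g₀ os K t τ,
          Real.exp (EB (fun i => runFlow D g₀ (K₀ g₀ os + (K + 1)) (i + 1)) (uB K v) Y
            - EB (fun i => runFlow D g₀ (K₀ g₀ os + (K + 1)) (i + 1)) oneB Y)) * oB g₀ os K t τ v = 0) ∧
      (∀ K t, |t| ≤ l₀ g₀ os → ∀ τ ∈ T g₀ os K \ Bad g₀ os K t, ∀ v ∈ R.dom, ∀ j ≤ K,
        |∑ Y ∈ fac g₀ os K t τ with C.scale Y = j,
            (Real.log (Real.exp (EB (fun i => runFlow D g₀ (K₀ g₀ os + (K + 1)) (i + 1)) (uB K v) Y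
                - EB (fun i => runFlow D g₀ (K₀ g₀ os + (K + 1)) (i + 1)) oneB Y))
              - Real.log (Real.exp (EA (runFlow D g₀ (K₀ g₀ os + K)) (uA K v) Y
                - EA (runFlow D g₀ (K₀ g₀ os + K)) oneA Y)))| ≤ Ssz g₀ os K t τ j) ∧
      (∀ K t, |t| ≤ l₀ g₀ os → ∀ τ ∈ T g₀ os K \ Bad g₀ os K t,
        Multiplicity (fac g₀ os K t τ) C.scale (fun Y => Real.exp (-(κ * C.d Y))) Cw (vol g₀ os) Λ K) ∧
      (∀ K t, |t| ≤ l₀ g₀ os → ∀ τ ∈ T g₀ os K \ Bad g₀ os K t, ∀ v ∈ R.dom,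
        |Real.log (oB g₀ os K t τ v) - Real.log (oA g₀ os K t τ v) - cO g₀ os K t τ| ≤ RO g₀ os K t τ) ∧
      (∀ K t, |t| ≤ l₀ g₀ os → ∀ τ ∈ T g₀ os K \ Bad g₀ os K t, ∀ j ≤ K,
        Ssz g₀ os K t τ j ≤ vol g₀ os * (E₀ * ((K : ℝ) + 1) ^ m * a ^ (K - j))) ∧
      (∀ K t, |t| ≤ l₀ g₀ os → ∀ τ ∈ T g₀ os K \ Bad g₀ os K t, RO g₀ os K t τ ≤ vol g₀ os * rO g₀ os K) ∧
      Summable (rO g₀ os) ∧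
      (∃ c₀ s : ℕ → ℝ, Summable s ∧ ∀ K t, |t| ≤ l₀ g₀ os → ∀ τ ∈ T g₀ os K \ Bad g₀ os K t,
        |cO g₀ os K t τ - c₀ K| ≤ vol g₀ os * s K)) :
    T4ApexHybrid.HybridNE7Under D Hβ := by
  intro hB hβ
  have H1 : ForSmallCouplings D _ := hU2 hB hβ
  have H2 : ForSmallCouplings D _ := hK5 hB hβ
  have H3 : ForSmallCouplings D _ := hRuns hB hβ
  have H4 : ForSmallCouplings D _ := hLink hB hβ
  obtain ⟨γ₀, hγ₀, Hγ⟩ := ((H1.and H2).and H3).and H4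
  refine ⟨γ₀, hγ₀, fun γ hγ hγle => ?_⟩
  obtain ⟨g₁, hg₁, Hg⟩ := Hγ γ hγ hγle
  refine ⟨g₁, hg₁, fun g hg hgle g₀ ht os => ?_⟩
  obtain ⟨⟨⟨hu2, hk5⟩, hruns⟩, hlink⟩ := Hg g hg hgle g₀ ht
  obtain ⟨hl₀, hvol, h20, h21, hlt, hE1, hE2⟩ := hk5 os
  obtain ⟨hG, hgA, hgB⟩ := hruns os
  obtain ⟨hfmtA, hfmtB, hint, hsc, hposO, hoff, hS, hM, hO, hSle, hRO, hrO, hcO⟩ := hlink os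
  have hbox : ∀ K i, i ≤ K →
      0 < runFlow D g₀ (K₀ g₀ os + K) i ∧ runFlow D g₀ (K₀ g₀ os + K) i ≤ γ := fun K i hi =>
    (ht (K₀ g₀ os + K)).1 i (hi.trans (Nat.le_add_left K (K₀ g₀ os)))
  have hinj : InjectedRate Cd 0 θc fun K j =>
      T4CouplingMatching.disc (runFlow D g₀ (K₀ g₀ os + K)) (runFlow D g₀ (K₀ g₀ os + (K + 1))) j :=
    injectedRate_shift hu2 (K₀ g₀ os)
  exact ⟨l₀ g₀ os, vol g₀ os, K₀ g₀ os, hl₀, hvol,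
    stringHybridNE7_of_spineRecord_sync (g := fun K => runFlow D g₀ (K₀ g₀ os + K)) (D.scheme g₀) os (K₀ g₀ os) h20 h21
      hlt hE1 hE2 h22 hω hUL hG hP h18 hθ₅ hC₅ h16 hC₃ hgd hinj hCd hθc hbox hgA hgB hθ' hθ₅' hθ₃' hθ'1 hθ'Λ hfmtA hfmtB
      hint hsc hposO hoff hS hM hO hvol hE₀ ha0 ha1 hSle hRO hrO hone hcO⟩

end Datum

end Summit.QuantumFields.YangMills.Theorems.BalabanUVNodesN27SpineRecord
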